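import Summits.HodgeConjecture.CorCM.IrreducibleOddWeightsOrbital
import Summits.HodgeConjecture.CorCM.IrreducibleOddWeightsCMFields
import HarnessLib

/-!
# CM fields with irreducible odd weights: every conjugate field over which `x₀(K)` does not gain a quadratic step is a
# commutant direction — `p` such fields in different `x₀(K)`-conjugacy classes cap nondegenerate families at `[K:ℚ]/(2p+2)`

COR-CM (cell `pub-hodgecm2`, binder seat `b16` gen 55, count-neutral claim IRR-ODD, file F3b — the CM-field dress of F3
`CorCM/IrreducibleOddWeightsOrbital`; theorems only, no definition, no named fact, no `sorry`).  NEW as stated, hence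
under `Summits/`.  HONEST FRAMING: statements about CM types of ONE CM field `K` and products of abelian varieties with
complex multiplication by `K`; `HC_CM` is neither used nor asserted — «HC for NAMED classes» / «exceptional classes for
NAMED classes».

Setting: `K` a CM field of degree `2n` whose odd weights are irreducible ((IRR), F2 `CorCM/IrreducibleOddWeightsCMFields`),
`x₀ : K → ℂ` a base embedding.  A WITNESS AGAINST (SC) at `x₀` is an embedding `y ∉ {x₀, x̄₀}` such that no
automorphism of `ℂ` fixes `x₀` and conjugates `y` — by seat gen 54's field test (`stabConj_at_iff_not_le`) exactly:
`x₀(K) ⊆ y(K) · x₀(K⁺)`.  Witnesses `y_1, …, y_p` are NON-ASSOCIATE if for `j ≠ k` no automorphism fixing `x₀` carries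
`y_j` to `y_k` or to `ȳ_k` (the fields `y_j(K)`, `y_k(K)`, `ȳ_k(K)` are pairwise non-conjugate over `x₀(K)`).

* **`succ_mul_card_le_of_irreducible_of_witnesses`** — `p` non-associate witnesses against (SC) ⟹ every nondegenerate
  family of CM types of `K` has `(p + 1)·|I| ≤ [K:ℚ]/2` (F3: the projection `f ↦ f − f∘ρ` and the `p` orbital operators
  are `p + 1` commutant directions, independent on `Anti`); `two_mul_card_le_of_irreducible_of_witness` (`p = 1`, the
  explicit-witness form of F2's `two_mul_card_le_of_irreducible_of_not_stabConj`), `…_of_le` (field-test form).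
* **`exists_exceptional_prod_of_irreducible_of_witnesses`** — MORE THAN `[K:ℚ]/(2p + 2)` pairwise non-isogenous abelian
  varieties with CM by `K` carry an exceptional Hodge class on some product `⨁_{j<N} A_{π j}`;
  `hodgeConjectureFor_prod_…` is F2's (the criterion itself does not change).
* Numerics (gen 54 census, not kernel): for the octic Galois types with (IRR) but not (SC), `p = 1` when the closure has
  order 16, 16, 16, 16, 24 (`SL₂(𝔽₃)`), 32 — capacity `2`, and the census finds exactly 4 same-field partners `Ψ` per
  type with `rank(Φ, Ψ) = rank Φ`; `p = 3` for the Galois `C₈`- and `Q₈`-octics — capacity `1` (Deligne–Shimura: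
  `rank ≤ 2n` for a Galois field, tree `CorCM/GaloisCMFieldExoticProducts`).

## References

* [Wielandt1964] H. Wielandt, *Finite Permutation Groups* (1964), Thm. 28.4.
* [Lang2002] S. Lang, *Algebra*, 3rd ed., V §2 Thm. 2.8, VI §1 Thm. 1.12 (the field test).
* [Serre1977] J.-P. Serre, *Linear Representations of Finite Groups*, GTM 42 (1977), §2.2 Prop. 4, §12.2.
* [Gordon1999HodgeAVSurvey] B. B. Gordon, *A survey of the Hodge conjecture for abelian varieties*, 7.5–7.7, 10.10.
-/

set_option autoImplicit false

noncomputable section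

open CategoryTheory CategoryTheory.Limits NumberField

namespace Summit.HodgeConjecture.CorCM

open Literature.NumberTheory.ComplexMultiplication
open Literature.AlgebraicGeometry.Motives (AbelianVariety CMType)
open Literature.AlgebraicGeometry.HodgeTheory
open Literature.AlgebraicGeometry.ComplexMultiplication (IsCMTypeRealisation)
open Literature.AlgebraicGeometry.Pohlmann1968
open Literature.Barriers.HodgeConjecture (divisorClassesSpan)
open GenericCMField

variable {K : Type} [Field K] [NumberField K] [IsCMField K] {I : Type} [Fintype I] [DecidableEq I] [Nonempty I]

/-! ## §1 Capacity from witnesses against (SC) -/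

section Capacity

/-- **`p` NON-ASSOCIATE WITNESSES AGAINST (SC) CAP NONDEGENERATE FAMILIES AT `[K:ℚ]/(2p+2)`.**  `K` with irreducible
odd weights; `y_1, …, y_p ∉ {x₀, x̄₀}` embeddings such that no `σ ∈ Aut(ℂ)` fixing `x₀` conjugates a `y_j`, and for
`j ≠ k` none carries `y_j` to `y_k` or `ȳ_k`: every nondegenerate family of CM types of `K` has `(p + 1)·|I| ≤ [K:ℚ]/2`.
[cite: Wielandt1964, Thm. 28.4] [cite: Serre1977, §2.2 Prop. 4 and §12.2] [cite: Gordon1999HodgeAVSurvey, 7.7] -/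
theorem succ_mul_card_le_of_irreducible_of_witnesses
    (hirr : ∀ W : Submodule ℚ ((K →+* ℂ) → ℚ), W ≤ antiWeights (E := K →+* ℂ) (starRingAut : ℂ ≃+* ℂ) → W ≠ ⊥ →
      (∀ (k : ℂ ≃+* ℂ) (f : (K →+* ℂ) → ℚ), f ∈ W → (fun y => f (k • y)) ∈ W) →
      W = antiWeights (E := K →+* ℂ) (starRingAut : ℂ ≃+* ℂ))
    {Φ : I → CMType K} (hΦ : CMAlgebra.IsNondegenerateFamily (K := fun _ : I => K) Φ)
    {p : ℕ} {x₀ : K →+* ℂ} (y : Fin p → (K →+* ℂ)) (hy₀ : ∀ j, y j ≠ x₀)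
    (hy₀' : ∀ j, y j ≠ (starRingAut : ℂ ≃+* ℂ) • x₀)
    (hncs : ∀ j (σ : ℂ ≃+* ℂ), σ • x₀ = x₀ → σ • y j ≠ (starRingAut : ℂ ≃+* ℂ) • y j)
    (hsep : ∀ j k, j ≠ k → ∀ σ : ℂ ≃+* ℂ, σ • x₀ = x₀ →
      σ • y j ≠ y k ∧ σ • y j ≠ (starRingAut : ℂ ≃+* ℂ) • y k) :
    (p + 1) * Fintype.card I ≤ Module.finrank ℚ K / 2 := by
  rw [isNondegenerateFamily_iff_typeRank_sigmaType_eq] at hΦ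
  rw [← Embeddings.card K ℂ]
  exact IrrOdd.succ_mul_card_le_of_irreducible_of_orbits (fun i => (Φ i).1) (fun i => isCMTypeWith_conj (Φ i)) hirr
    hΦ y hy₀ hy₀' hncs hsep

/-- **One witness against (SC)** (`y₀ ∉ {x₀, x̄₀}`, no automorphism fixes `x₀` and conjugates `y₀`): a nondegenerate
family of CM types of the (IRR) field has `2|I| ≤ [K:ℚ]/2`. [cite: Wielandt1964, Thm. 28.4] [cite: Gordon1999HodgeAVSurvey, 7.7] -/
theorem two_mul_card_le_of_irreducible_of_witness
    (hirr : ∀ W : Submodule ℚ ((K →+* ℂ) → ℚ), W ≤ antiWeights (E := K →+* ℂ) (starRingAut : ℂ ≃+* ℂ) → W ≠ ⊥ →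
      (∀ (k : ℂ ≃+* ℂ) (f : (K →+* ℂ) → ℚ), f ∈ W → (fun y => f (k • y)) ∈ W) →
      W = antiWeights (E := K →+* ℂ) (starRingAut : ℂ ≃+* ℂ))
    {Φ : I → CMType K} (hΦ : CMAlgebra.IsNondegenerateFamily (K := fun _ : I => K) Φ)
    {x₀ y₀ : K →+* ℂ} (hy₀ : y₀ ≠ x₀) (hy₀' : y₀ ≠ (starRingAut : ℂ ≃+* ℂ) • x₀)
    (hncs : ∀ σ : ℂ ≃+* ℂ, σ • x₀ = x₀ → σ • y₀ ≠ (starRingAut : ℂ ≃+* ℂ) • y₀) :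
    2 * Fintype.card I ≤ Module.finrank ℚ K / 2 := by
  rw [isNondegenerateFamily_iff_typeRank_sigmaType_eq] at hΦ
  rw [← Embeddings.card K ℂ]
  exact IrrOdd.two_mul_card_le_of_irreducible_of_not_stabConj_at (fun i => (Φ i).1)
    (fun i => isCMTypeWith_conj (Φ i)) hirr hΦ hy₀ hy₀' hncs

/-- **One witness, FIELD-TEST form**: `y₀ ∉ {x₀, x̄₀}` with `x₀(K) ⊆ y₀(K) · x₀(K⁺)` (the compositum of the conjugate
field `y₀(K)` with the real field `x₀(K⁺)` already contains `x₀(K)`; seat gen 54 `stabConj_at_iff_not_le`) ⟹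
`2|I| ≤ [K:ℚ]/2` for every nondegenerate family. [cite: Lang2002, V §2 Thm. 2.8 and VI §1 Thm. 1.12]
[cite: Gordon1999HodgeAVSurvey, 7.7] -/
theorem two_mul_card_le_of_irreducible_of_le
    (hirr : ∀ W : Submodule ℚ ((K →+* ℂ) → ℚ), W ≤ antiWeights (E := K →+* ℂ) (starRingAut : ℂ ≃+* ℂ) → W ≠ ⊥ →
      (∀ (k : ℂ ≃+* ℂ) (f : (K →+* ℂ) → ℚ), f ∈ W → (fun y => f (k • y)) ∈ W) →
      W = antiWeights (E := K →+* ℂ) (starRingAut : ℂ ≃+* ℂ))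
    {Φ : I → CMType K} (hΦ : CMAlgebra.IsNondegenerateFamily (K := fun _ : I => K) Φ)
    {x₀ y₀ : K →+* ℂ} (hy₀ : y₀ ≠ x₀) (hy₀' : y₀ ≠ (starRingAut : ℂ ≃+* ℂ) • x₀)
    (hle : x₀.toRatAlgHom.fieldRange ≤
      y₀.toRatAlgHom.fieldRange ⊔ (x₀.comp (maximalRealSubfield K).subtype).toRatAlgHom.fieldRange) :
    2 * Fintype.card I ≤ Module.finrank ℚ K / 2 := by
  refine two_mul_card_le_of_irreducible_of_witness hirr hΦ hy₀ hy₀' fun σ hσ hσy => ?_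
  exact (stabConj_at_iff_not_le x₀ y₀).1 ⟨σ, hσ, hσy⟩ hle

/-- … hence **at most `[K:ℚ]/(2p + 2)` members**. [cite: Gordon1999HodgeAVSurvey, 7.7] -/
theorem card_le_finrank_div_of_irreducible_of_witnesses
    (hirr : ∀ W : Submodule ℚ ((K →+* ℂ) → ℚ), W ≤ antiWeights (E := K →+* ℂ) (starRingAut : ℂ ≃+* ℂ) → W ≠ ⊥ →
      (∀ (k : ℂ ≃+* ℂ) (f : (K →+* ℂ) → ℚ), f ∈ W → (fun y => f (k • y)) ∈ W) →
      W = antiWeights (E := K →+* ℂ) (starRingAut : ℂ ≃+* ℂ))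
    {Φ : I → CMType K} (hΦ : CMAlgebra.IsNondegenerateFamily (K := fun _ : I => K) Φ)
    {p : ℕ} {x₀ : K →+* ℂ} (y : Fin p → (K →+* ℂ)) (hy₀ : ∀ j, y j ≠ x₀)
    (hy₀' : ∀ j, y j ≠ (starRingAut : ℂ ≃+* ℂ) • x₀)
    (hncs : ∀ j (σ : ℂ ≃+* ℂ), σ • x₀ = x₀ → σ • y j ≠ (starRingAut : ℂ ≃+* ℂ) • y j)
    (hsep : ∀ j k, j ≠ k → ∀ σ : ℂ ≃+* ℂ, σ • x₀ = x₀ →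
      σ • y j ≠ y k ∧ σ • y j ≠ (starRingAut : ℂ ≃+* ℂ) • y k) :
    Fintype.card I ≤ Module.finrank ℚ K / 2 / (p + 1) := by
  have h := succ_mul_card_le_of_irreducible_of_witnesses hirr hΦ y hy₀ hy₀' hncs hsep
  exact (Nat.le_div_iff_mul_le (Nat.succ_pos p)).2 (by rwa [mul_comm] at h)

end Capacity

/-! ## §2 Exceptional Hodge classes beyond the capacity -/

section Varieties

variable {Φ : I → CMType K} {A : I → AbelianVariety ℂ} {ι : ∀ i, 𝓞 K →+* End (A i)}
  {θ : ∀ i, K →+* Module.End ℂ (complexBetti (A i).X 1)}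

/-- **MORE THAN `[K:ℚ]/(2p + 2)` PAIRWISE NON-ISOGENOUS ABELIAN VARIETIES WITH CM BY AN (IRR) FIELD WITH `p`
NON-ASSOCIATE WITNESSES AGAINST (SC) CARRY AN EXCEPTIONAL HODGE CLASS ON SOME PRODUCT** (the family is separating —
every member is simple by F2 — but exceeds the capacity). [cite: Gordon1999HodgeAVSurvey, 7.6.1 and 7.7]
[cite: Wielandt1964, Thm. 28.4] -/
theorem exists_exceptional_prod_of_irreducible_of_witnesses
    (hirr : ∀ W : Submodule ℚ ((K →+* ℂ) → ℚ), W ≤ antiWeights (E := K →+* ℂ) (starRingAut : ℂ ≃+* ℂ) → W ≠ ⊥ →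
      (∀ (k : ℂ ≃+* ℂ) (f : (K →+* ℂ) → ℚ), f ∈ W → (fun y => f (k • y)) ∈ W) →
      W = antiWeights (E := K →+* ℂ) (starRingAut : ℂ ≃+* ℂ))
    {p : ℕ} {x₀ : K →+* ℂ} (y : Fin p → (K →+* ℂ)) (hy₀ : ∀ j, y j ≠ x₀)
    (hy₀' : ∀ j, y j ≠ (starRingAut : ℂ ≃+* ℂ) • x₀)
    (hncs : ∀ j (σ : ℂ ≃+* ℂ), σ • x₀ = x₀ → σ • y j ≠ (starRingAut : ℂ ≃+* ℂ) • y j)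
    (hsep : ∀ j k, j ≠ k → ∀ σ : ℂ ≃+* ℂ, σ • x₀ = x₀ →
      σ • y j ≠ y k ∧ σ • y j ≠ (starRingAut : ℂ ≃+* ℂ) • y k)
    (hA : ∀ i, IsCMTypeRealisation (Φ i) (A i) (ι i) (θ i))
    (hniso : ∀ i j, i ≠ j → ¬AbelianVariety.IsIsogenous (A i) (A j))
    (hcard : Module.finrank ℚ K / 2 < (p + 1) * Fintype.card I) :
    ∃ (N : ℕ) (π : Fin N → I) (m : ℕ) (c : complexBetti (⨁ fun j : Fin N => A (π j)).X (2 * m)),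
      IsRationalClass c ∧
      IsOfHodgeType (⨁ fun j : Fin N => A (π j)).dim (⨁ fun j : Fin N => A (π j)).X (2 * m) m m c ∧
      c ∉ divisorClassesSpan (⨁ fun j : Fin N => A (π j)).X (⨁ fun j : Fin N => A (π j)).dim m :=
  CMAlgebra.exists_exceptional_prod_of_not_isNondegenerateFamily (K := fun _ : I => K)
    (CMAlgebra.isSeparatingFamily_of_isSimple_of_pairwise_not_isIsogenous hA
      (fun i => isSimple_of_irreducible hirr (hA i)) hniso)
    (fun hΦ => absurd (succ_mul_card_le_of_irreducible_of_witnesses hirr hΦ y hy₀ hy₀' hncs hsep) (not_le.2 hcard))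
    hA

/-- **One witness against (SC), in field form: more than `[K:ℚ]/4` pairwise non-isogenous abelian varieties with CM by
the (IRR) field carry an exceptional Hodge class on some product** — e.g. any three simple CM abelian fourfolds with CM
by one octic (IRR) field `K` having embeddings `x₀`, `y₀ ∉ {x₀, x̄₀}` with `x₀(K) ⊆ y₀(K)·x₀(K⁺)`.
[cite: Gordon1999HodgeAVSurvey, 7.6.1 and 7.7] [cite: Lang2002, V §2 Thm. 2.8 and VI §1 Thm. 1.12] -/
theorem exists_exceptional_prod_of_irreducible_of_le
    (hirr : ∀ W : Submodule ℚ ((K →+* ℂ) → ℚ), W ≤ antiWeights (E := K →+* ℂ) (starRingAut : ℂ ≃+* ℂ) → W ≠ ⊥ →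
      (∀ (k : ℂ ≃+* ℂ) (f : (K →+* ℂ) → ℚ), f ∈ W → (fun y => f (k • y)) ∈ W) →
      W = antiWeights (E := K →+* ℂ) (starRingAut : ℂ ≃+* ℂ))
    {x₀ y₀ : K →+* ℂ} (hy₀ : y₀ ≠ x₀) (hy₀' : y₀ ≠ (starRingAut : ℂ ≃+* ℂ) • x₀)
    (hle : x₀.toRatAlgHom.fieldRange ≤
      y₀.toRatAlgHom.fieldRange ⊔ (x₀.comp (maximalRealSubfield K).subtype).toRatAlgHom.fieldRange)
    (hA : ∀ i, IsCMTypeRealisation (Φ i) (A i) (ι i) (θ i))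
    (hniso : ∀ i j, i ≠ j → ¬AbelianVariety.IsIsogenous (A i) (A j))
    (hcard : Module.finrank ℚ K / 4 < Fintype.card I) :
    ∃ (N : ℕ) (π : Fin N → I) (m : ℕ) (c : complexBetti (⨁ fun j : Fin N => A (π j)).X (2 * m)),
      IsRationalClass c ∧
      IsOfHodgeType (⨁ fun j : Fin N => A (π j)).dim (⨁ fun j : Fin N => A (π j)).X (2 * m) m m c ∧
      c ∉ divisorClassesSpan (⨁ fun j : Fin N => A (π j)).X (⨁ fun j : Fin N => A (π j)).dim m :=
  CMAlgebra.exists_exceptional_prod_of_not_isNondegenerateFamily (K := fun _ : I => K)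
    (CMAlgebra.isSeparatingFamily_of_isSimple_of_pairwise_not_isIsogenous hA
      (fun i => isSimple_of_irreducible hirr (hA i)) hniso)
    (fun hΦ => by
      have h := two_mul_card_le_of_irreducible_of_le hirr hΦ hy₀ hy₀' hle
      omega)
    hA

end Varieties

end Summit.HodgeConjecture.CorCM

end
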